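/-
Copyright (c) 2026 the pub-hodgecm-mathlib formalisation cell (harness21).  Prover seat hodgecm-mathlib-LH4-p09 (g10) (VALVE hand, LEAD F0P6-plan (g14)
BATCH #88 (4)), Track B «K2-LIT» ∕ hLiu418 #184♮, ROAD Φ, the (K1b-W) cut of K2Liu-p14 (g4), LINE WORD #1 (4) (Q2): (KW1-d) edition 2 = THE IWASAWA-POINT
READING of the rank-one archimedean Whittaker integral (tube frame `l := Fin 1`).  THEOREMS ONLY.
-/
import Summits.HodgeConjecture.HodgeConjecture.Theorems.K2LiuKindOneLineWhittakerDecay         -- ★ (KW1-d) ed. 1: the arch line letters, rate `π`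
import Summits.HodgeConjecture.HodgeConjecture.Theorems.K2LiuArchWhittakerLeviEquivariance      -- ★ (V-L1): `section_J_transl_levi`, `norm_det_levi`, … (generic `l`)
import Summits.HodgeConjecture.HodgeConjecture.Theorems.K2LiuArchInducedTubeSection             -- ★ (A∞-0b): `isArchSiegelSection_archScalarSection`
import Mathlib.MeasureTheory.Measure.Haar.NormedSpace
import HarnessLib

/-!
# Crux `HLiu418`, KIND 1, file (KW1-d) edition 2 `K2LiuKindOneLineWhittakerIwasawa`: THE IWASAWA-POINT READING OF THE LINE WHITTAKER INTEGRAL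

Cell `hodgecm-mathlib`, crux item hLiu418 = `stmt-HodgeConjecture-24832` (helper lane `--supports … --as helper`, count-neutral), route of record
`HCCMUnconditional`; squad K2 ∕ K2Liu, LEAD F0P6-plan (g14); line lead K2Liu-p14 (g4) (LINE WORD #1 (4) (Q2): «the Iwasawa-point reading at `n = 1`
is (KW1-d) ED. 2; pattern ★ `K2LiuArchWhittakerLeviEquivariance` §2 re-run at `l := Fin 1`»), K1 desk F0P2-p11 (g2).  A separate file only because of the
400-line rule.  THEOREMS ONLY (no `def`, no `instance`, no notation, no named-fact hypothesis, no `sorry`).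

FRAME (★ (D∞) `K2LiuArchInducedTubeDefs`, `l := Fin 1`, i.e. `U(1,1)`): `J = (0 −1; 1 0)`, `n(x) = (1 x; 0 1)`, `m(a,d) = (a 0; 0 d)` with `aᴴ d = 1`;
a Siegel section `f` of `I_w(s, χ)` (`IsArchSiegelSection χ s f`); the LINE Whittaker integral at the real index `h` and the point `g`,
`W_h(f)(g) = ∫_ℝ f (J · n(β•1) · g) · e^{−2πihβ} dβ` (Lebesgue measure; W1-arch currency ★ `K2LiuRankOneArchWhittakerCentre`).
* §1 **`lineWhittaker_transl`** — the unipotent step: `∫ f(J·n(β•1)·n(b₀•1)) e^{−2πihβ} dβ = e^{2πihb₀} · ∫ f(J·n(β•1)) e^{−2πihβ} dβ` (any `f`; `n(β)n(b₀) = n(β+b₀)`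
  and translation invariance of Lebesgue measure).
* §2 **`lineWhittaker_levi`** — the Levi step (★ `section_J_transl_levi` at `l := Fin 1` + the substitution `β ↦ ‖d₀₀‖²β`):
  `∫ f(J·n(β•1)·m(a,d)) e^{−2πihβ} dβ = χ(d₀₀) · ‖a₀₀‖^{1−2s} · ∫ f(J·n(β•1)) e^{−2πi(‖a₀₀‖²h)β} dβ` — the `n = 1` twin of ★ `whittaker_levi_equivariance`
  (honest exponent `1 − 2s`; index `aᴴ h a = ‖a₀₀‖² h`).
* §3 **`lineWhittaker_iwasawa`** — both: `W_h(f)(n(b₀•1)·m(a,d)) = e^{2πihb₀} · χ(d₀₀) · ‖a₀₀‖^{1−2s} · W_{‖a₀₀‖²h}(f)(1)`.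
* §4 **THE READING FOR THE SCALAR TYPES** (★ `isArchSiegelSection_archScalarSection`, `|χ_k(d₀₀)| = 1`) against ★ (KW1-d) ed. 1's letters: near every `z₀`
  with `re z₀ > ½`, for `k = ±1`,
  `‖W^{(k)}_h(s)(n(b₀•1)·m(a,d))‖ ≤ C · ‖a₀₀‖^{1−2 re s} · (1 + ‖a₀₀‖²|h|) · e^{−π‖a₀₀‖²|h|}`
  (`norm_lineWhittaker_iwasawa_le`, `…_neg_le`) — EXACTLY the per-place input `t_σ = ½|h|`, `y_σ 0 0 = a₀₀` of ★ `lineDecay_le_exp_neg_height` ∕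
  ★ `prod_one_add_mul_normSq_pow_le_height` (up to `2π·½ = π`).
It consumes (KW1-e∞)'s output «arch factor `= c(s,g_∞) · W⁽¹⁾_μ(φ_k)(x_∞)`, `x_∞ = n₁(b)·m₁(r) ∈ P₁`» token for token (`g := n(b₀•1)·m(a•1,d•1)`).
References: [Shimura1997] §16; [Bump1997] §1.6, §3.7; G. Shimura, Math. Ann. 260 (1982) (3.2).
HONEST LABEL.  Count-neutral helper; closes no socket: `HC_CM` is proved only modulo the 7 printed citations (2 remaining named inputs: hLiu418 =
`stmt-HodgeConjecture-24832`, h413 = `stmt-HodgeConjecture-24833`) until rung 0 closes.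
-/

set_option autoImplicit false
set_option linter.dupNamespace false -- the mandated namespace repeats `HodgeConjecture.HodgeConjecture`

noncomputable section

open Complex MeasureTheory Matrix Set Filter
open scoped ComplexConjugate Matrix

namespace Summit.HodgeConjecture.HodgeConjecture.Cruxes.HLiu418.K2LiuKindOneLineWhittakerIwasawa

open Summit.HodgeConjecture.HodgeConjecture.Cruxes.HLiu418.K2LiuArchInducedTubeDefs
open Summit.HodgeConjecture.HodgeConjecture.Cruxes.HLiu418.K2LiuArchInducedTubeSection (isArchSiegelSection_archScalarSection)
open Summit.HodgeConjecture.HodgeConjecture.Cruxes.HLiu418.K2LiuArchWhittakerLeviEquivariance (section_J_transl_levi norm_det_levi levi_inverse_letters)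
open Summit.HodgeConjecture.HodgeConjecture.Cruxes.HLiu418.K2LiuKindOneLineWhittakerDecay (exists_forall_norm_archLineWhittaker_le
  exists_forall_norm_archLineWhittaker_neg_le)

/-! ## §1 The unipotent step -/

/-- `n(x) · n(y) = n(x + y)`. [folklore] -/
theorem transl_mul_transl {l : Type*} [Fintype l] [DecidableEq l] (x y : Matrix l l ℂ) :
    fromBlocks 1 x 0 1 * fromBlocks 1 y 0 1 = (fromBlocks 1 (x + y) 0 1 : Matrix (l ⊕ l) (l ⊕ l) ℂ) := by
  rw [fromBlocks_multiply]
  simp [add_comm]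

/-- **THE UNIPOTENT STEP**: `∫ f(J·n(β•1)·n(b₀•1)) e^{−2πihβ} dβ = e^{2πihb₀} · ∫ f(J·n(β•1)) e^{−2πihβ} dβ` for ANY `f` (no integrability needed: both
sides vanish together otherwise) — `n(β)n(b₀) = n(β + b₀)` and `β ↦ β + b₀` preserves Lebesgue measure. [cite: Shimura1997, §16] [cite: Bump1997, §1.6] -/
theorem lineWhittaker_transl (f : Matrix (Fin 1 ⊕ Fin 1) (Fin 1 ⊕ Fin 1) ℂ → ℂ) (b₀ h : ℝ) :
    ∫ β : ℝ, f (Matrix.J (Fin 1) ℂ * fromBlocks 1 ((β : ℂ) • (1 : Matrix (Fin 1) (Fin 1) ℂ)) 0 1 * fromBlocks 1 ((b₀ : ℂ) • (1 : Matrix (Fin 1) (Fin 1) ℂ)) 0 1) *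
        Complex.exp (-(2 * Real.pi * I * h * β)) =
      Complex.exp (2 * Real.pi * I * h * b₀) *
        ∫ β : ℝ, f (Matrix.J (Fin 1) ℂ * fromBlocks 1 ((β : ℂ) • (1 : Matrix (Fin 1) (Fin 1) ℂ)) 0 1) * Complex.exp (-(2 * Real.pi * I * h * β)) := by
  -- the integrand is `G (β + b₀)` with `G t = f(J n(t•1)) · e^{2πihb₀} · e^{−2πiht}`
  set G : ℝ → ℂ := fun t => f (Matrix.J (Fin 1) ℂ * fromBlocks 1 ((t : ℂ) • (1 : Matrix (Fin 1) (Fin 1) ℂ)) 0 1) *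
    (Complex.exp (2 * Real.pi * I * h * b₀) * Complex.exp (-(2 * Real.pi * I * h * t))) with hG
  have hpt : ∀ β : ℝ, f (Matrix.J (Fin 1) ℂ * fromBlocks 1 ((β : ℂ) • (1 : Matrix (Fin 1) (Fin 1) ℂ)) 0 1 *
        fromBlocks 1 ((b₀ : ℂ) • (1 : Matrix (Fin 1) (Fin 1) ℂ)) 0 1) * Complex.exp (-(2 * Real.pi * I * h * β)) = G (β + b₀) := fun β => by
    rw [hG]
    simp only
    rw [Matrix.mul_assoc, transl_mul_transl, ← add_smul, ← Complex.ofReal_add, ← Complex.exp_add]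
    congr 2
    push_cast
    ring
  rw [integral_congr_ae (Filter.Eventually.of_forall hpt), integral_add_right_eq_self G b₀, hG]
  simp only
  rw [← integral_const_mul]
  refine integral_congr_ae (Filter.Eventually.of_forall fun β => ?_)
  simp only
  ring

/-! ## §2 The Levi step -/

/-- 1×1 bookkeeping: `dᴴ · (β•1) · d = (β‖d₀₀‖²)•1`. [folklore] -/
theorem conjTranspose_mul_smul_one_mul (d : Matrix (Fin 1) (Fin 1) ℂ) (β : ℝ) :
    dᴴ * ((β : ℂ) • (1 : Matrix (Fin 1) (Fin 1) ℂ)) * d = (((β * ‖d 0 0‖ ^ 2 : ℝ)) : ℂ) • (1 : Matrix (Fin 1) (Fin 1) ℂ) := by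
  ext i j
  fin_cases i; fin_cases j
  simp only [Matrix.mul_apply, Fin.sum_univ_one, Matrix.smul_apply, Matrix.one_apply_eq, smul_eq_mul, mul_one, conjTranspose_apply,
    Complex.star_def, Fin.zero_eta, Fin.isValue]
  rw [Complex.ofReal_mul, Complex.ofReal_pow, ← Complex.conj_mul']
  ring

/-- Scalar bookkeeping: `(ρ⁻¹)^{2s+1} · ρ² = ρ^{1−2s}` for `ρ > 0` (principal powers of positive reals). [folklore] -/
theorem inv_cpow_mul_sq {ρ : ℝ} (hρ : 0 < ρ) (s : ℂ) :
    ((ρ⁻¹ : ℝ) : ℂ) ^ (2 * s + 1) * ((ρ ^ 2 : ℝ) : ℂ) = (ρ : ℂ) ^ (1 - 2 * s) := by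
  have hρ0 : (ρ : ℂ) ≠ 0 := Complex.ofReal_ne_zero.2 hρ.ne'
  have harg : (ρ : ℂ).arg ≠ Real.pi := by
    rw [Complex.arg_ofReal_of_nonneg hρ.le]
    exact Real.pi_ne_zero.symm
  rw [Complex.ofReal_inv, Complex.inv_cpow _ _ harg, show (1 - 2 * s : ℂ) = (2 : ℂ) - (2 * s + 1) by ring, Complex.cpow_sub _ _ hρ0,
    Complex.ofReal_pow, Complex.cpow_two, div_eq_mul_inv, mul_comm]

/-- **THE LEVI STEP at `l = Fin 1`** (the `n = 1` twin of ★ `whittaker_levi_equivariance`).  For a Siegel section `f` of `I_w(s, χ)`, a Levi element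
`m(a,d)` (`aᴴ d = 1`) and a real index `h`:
`∫ f(J·n(β•1)·m(a,d)) e^{−2πihβ} dβ = χ(d₀₀) · ‖a₀₀‖^{1−2s} · ∫ f(J·n(β•1)) e^{−2πi(‖a₀₀‖²h)β} dβ`
(★ `section_J_transl_levi`: the section law at `m(d,a)` gives `χ(d₀₀)‖d₀₀‖^{2s+1}` and the argument `n(‖d₀₀‖²β•1)`; the substitution `β ↦ ‖d₀₀‖²β`
gives `‖d₀₀‖^{−2}` and the index `‖d₀₀‖^{−2}h = ‖a₀₀‖²h`; `‖d₀₀‖ = ‖a₀₀‖⁻¹`).  No integrability hypothesis. [cite: Shimura1997, §16] -/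
theorem lineWhittaker_levi {χ : ℂ → ℂ} {s : ℂ} {f : Matrix (Fin 1 ⊕ Fin 1) (Fin 1 ⊕ Fin 1) ℂ → ℂ} (hf : IsArchSiegelSection χ s f)
    {a d : Matrix (Fin 1) (Fin 1) ℂ} (had : aᴴ * d = 1) (h : ℝ) :
    ∫ β : ℝ, f (Matrix.J (Fin 1) ℂ * fromBlocks 1 ((β : ℂ) • (1 : Matrix (Fin 1) (Fin 1) ℂ)) 0 1 * fromBlocks a 0 0 d) *
        Complex.exp (-(2 * Real.pi * I * h * β)) =
      χ (d 0 0) * ((‖a 0 0‖ : ℝ) : ℂ) ^ (1 - 2 * s) *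
        ∫ β : ℝ, f (Matrix.J (Fin 1) ℂ * fromBlocks 1 ((β : ℂ) • (1 : Matrix (Fin 1) (Fin 1) ℂ)) 0 1) *
          Complex.exp (-(2 * Real.pi * I * ((‖a 0 0‖ ^ 2 * h : ℝ) : ℂ) * β)) := by
  obtain ⟨ha, hnd⟩ := norm_det_levi had
  rw [Matrix.det_fin_one] at ha
  rw [Matrix.det_fin_one, Matrix.det_fin_one] at hnd
  have hρ : 0 < ‖a 0 0‖ := norm_pos_iff.2 ha
  set r : ℝ := ‖d 0 0‖ ^ 2 with hr
  have hdpos : 0 < ‖d 0 0‖ := by rw [hnd]; exact inv_pos.2 hρ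
  have hr0 : 0 < r := by positivity
  have hra : r = (‖a 0 0‖ ^ 2)⁻¹ := by rw [hr, hnd, inv_pow]
  have hcard : (Fintype.card (Fin 1) : ℂ) = 1 := by simp
  -- the section law at `m(d, a)`, pointwise; the new argument is `n((rβ)•1)` and the phase is `e^{−2πi (h/r)(rβ)}`
  set G : ℝ → ℂ := fun t => f (Matrix.J (Fin 1) ℂ * fromBlocks 1 ((t : ℂ) • (1 : Matrix (Fin 1) (Fin 1) ℂ)) 0 1) *
    Complex.exp (-(2 * Real.pi * I * ((‖a 0 0‖ ^ 2 * h : ℝ) : ℂ) * t)) with hG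
  have step1 : ∀ β : ℝ, f (Matrix.J (Fin 1) ℂ * fromBlocks 1 ((β : ℂ) • (1 : Matrix (Fin 1) (Fin 1) ℂ)) 0 1 * fromBlocks a 0 0 d) *
        Complex.exp (-(2 * Real.pi * I * h * β)) =
      χ (d 0 0) * ((‖d 0 0‖ : ℝ) : ℂ) ^ (2 * s + 1) * G (r * β) := fun β => by
    rw [section_J_transl_levi hf had, hcard, Matrix.det_fin_one, conjTranspose_mul_smul_one_mul, hG]
    simp only
    have hphase : Complex.exp (-(2 * Real.pi * I * h * β)) = Complex.exp (-(2 * Real.pi * I * ((‖a 0 0‖ ^ 2 * h : ℝ) : ℂ) * ((r * β : ℝ) : ℂ))) := by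
      congr 1
      have hra' : ((‖a 0 0‖ : ℝ) : ℂ) ^ 2 * (r : ℂ) = 1 := by
        rw [← Complex.ofReal_pow, ← Complex.ofReal_mul, hra, mul_inv_cancel₀ (pow_ne_zero _ hρ.ne'), Complex.ofReal_one]
      push_cast
      linear_combination (2 * Real.pi * I * (h : ℂ) * (β : ℂ)) * hra'
    rw [hphase, show (β * ‖d 0 0‖ ^ 2 : ℝ) = r * β by rw [hr]; ring]
    ring
  rw [integral_congr_ae (Filter.Eventually.of_forall step1), integral_const_mul, Measure.integral_comp_mul_left G r,
    abs_of_pos (inv_pos.2 hr0), Complex.real_smul, ← mul_assoc]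
  congr 1
  rw [mul_assoc, hnd, hr, hnd, inv_pow, inv_inv, inv_cpow_mul_sq hρ]

/-! ## §3 The Iwasawa point `n(b₀•1) · m(a,d)` -/

/-- **THE IWASAWA-POINT READING**: for a Siegel section `f` of `I_w(s,χ)`, `aᴴ d = 1`, real `b₀`, `h`:
`W_h(f)(n(b₀•1)·m(a,d)) = e^{2πihb₀} · χ(d₀₀) · ‖a₀₀‖^{1−2s} · W_{‖a₀₀‖²h}(f)(1)` (§1 after §2: `n(β)·(n(b₀)·m) = (n(β)·n(b₀))·m`). [cite: Shimura1997, §16] -/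
theorem lineWhittaker_iwasawa {χ : ℂ → ℂ} {s : ℂ} {f : Matrix (Fin 1 ⊕ Fin 1) (Fin 1 ⊕ Fin 1) ℂ → ℂ} (hf : IsArchSiegelSection χ s f)
    {a d : Matrix (Fin 1) (Fin 1) ℂ} (had : aᴴ * d = 1) (b₀ h : ℝ) :
    ∫ β : ℝ, f (Matrix.J (Fin 1) ℂ * fromBlocks 1 ((β : ℂ) • (1 : Matrix (Fin 1) (Fin 1) ℂ)) 0 1 *
          (fromBlocks 1 ((b₀ : ℂ) • (1 : Matrix (Fin 1) (Fin 1) ℂ)) 0 1 * fromBlocks a 0 0 d)) * Complex.exp (-(2 * Real.pi * I * h * β)) =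
      Complex.exp (2 * Real.pi * I * h * b₀) * (χ (d 0 0) * ((‖a 0 0‖ : ℝ) : ℂ) ^ (1 - 2 * s)) *
        ∫ β : ℝ, f (Matrix.J (Fin 1) ℂ * fromBlocks 1 ((β : ℂ) • (1 : Matrix (Fin 1) (Fin 1) ℂ)) 0 1) *
          Complex.exp (-(2 * Real.pi * I * ((‖a 0 0‖ ^ 2 * h : ℝ) : ℂ) * β)) := by
  -- the right translate `F g := f (g · m(a,d))`: §1 applies to `F`, then `F(J·n(β•1)) = f(J·n(β•1)·m(a,d))` and §2 applies to `f`
  set F : Matrix (Fin 1 ⊕ Fin 1) (Fin 1 ⊕ Fin 1) ℂ → ℂ := fun g => f (g * fromBlocks a 0 0 d) with hF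
  have h1 : ∀ β : ℝ, f (Matrix.J (Fin 1) ℂ * fromBlocks 1 ((β : ℂ) • (1 : Matrix (Fin 1) (Fin 1) ℂ)) 0 1 *
        (fromBlocks 1 ((b₀ : ℂ) • (1 : Matrix (Fin 1) (Fin 1) ℂ)) 0 1 * fromBlocks a 0 0 d)) * Complex.exp (-(2 * Real.pi * I * h * β)) =
      F (Matrix.J (Fin 1) ℂ * fromBlocks 1 ((β : ℂ) • (1 : Matrix (Fin 1) (Fin 1) ℂ)) 0 1 *
        fromBlocks 1 ((b₀ : ℂ) • (1 : Matrix (Fin 1) (Fin 1) ℂ)) 0 1) * Complex.exp (-(2 * Real.pi * I * h * β)) := fun β => by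
    simp only [hF, Matrix.mul_assoc]
  have h2 : (∫ β : ℝ, F (Matrix.J (Fin 1) ℂ * fromBlocks 1 ((β : ℂ) • (1 : Matrix (Fin 1) (Fin 1) ℂ)) 0 1) * Complex.exp (-(2 * Real.pi * I * h * β))) =
      ∫ β : ℝ, f (Matrix.J (Fin 1) ℂ * fromBlocks 1 ((β : ℂ) • (1 : Matrix (Fin 1) (Fin 1) ℂ)) 0 1 * fromBlocks a 0 0 d) *
        Complex.exp (-(2 * Real.pi * I * h * β)) :=
    integral_congr_ae (Filter.Eventually.of_forall fun β => by simp only [hF])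
  rw [integral_congr_ae (Filter.Eventually.of_forall h1), lineWhittaker_transl F b₀ h, h2, lineWhittaker_levi hf had h]
  ring

/-! ## §4 The reading for the scalar types against the (KW1-d) letters -/

/-- `|χ_k(z)| = 1` for `z ≠ 0`, `χ_k(z) = (z̄∕‖z‖)^k`. [folklore] -/
theorem norm_chiK_eq_one (k : ℤ) {z : ℂ} (hz : z ≠ 0) : ‖(conj z / ((‖z‖ : ℝ) : ℂ)) ^ k‖ = 1 := by
  rw [norm_zpow, norm_div, Complex.norm_conj, Complex.norm_real, Real.norm_of_nonneg (norm_nonneg _), div_self (norm_ne_zero_iff.2 hz), _root_.one_zpow]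

/-- `‖e^{2πihb₀}‖ = 1`. [folklore] -/
theorem norm_exp_phase (h b₀ : ℝ) : ‖Complex.exp (2 * Real.pi * I * h * b₀)‖ = 1 := by
  rw [show (2 * Real.pi * I * h * b₀ : ℂ) = ((2 * Real.pi * h * b₀ : ℝ) : ℂ) * I by push_cast; ring]
  exact Complex.norm_exp_ofReal_mul_I _

/-- **THE IWASAWA-POINT LETTER, TYPE `k = 1`**: for `re z₀ > ½` there are `C ≥ 0`, `r > 0` with, for all `s` (`dist s z₀ < r`), all real `b₀ h` and all
`m(a,d)` (`aᴴ d = 1`):  `‖W^{(1)}_h(s)(n(b₀•1)·m(a,d))‖ ≤ C · ‖a₀₀‖^{1−2 re s} · (1 + ‖a₀₀‖²|h|) · e^{−π‖a₀₀‖²|h|}`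
(§3 for `f⁰_{s,1}` — a Siegel section of `I_w(s,χ₁)` by ★ `isArchSiegelSection_archScalarSection` — then ★ `exists_forall_norm_archLineWhittaker_le` at the index
`‖a₀₀‖²h`; `|e^{2πihb₀}| = |χ₁(d₀₀)| = 1`, `‖ρ^{1−2s}‖ = ρ^{1−2re s}`). [cite: Bump1997, §1.6, §3.7] [cite: Shimura1997, §16] -/
theorem norm_lineWhittaker_iwasawa_le {z₀ : ℂ} (hz₀ : 1 / 2 < z₀.re) :
    ∃ C r : ℝ, 0 ≤ C ∧ 0 < r ∧ ∀ s : ℂ, dist s z₀ < r → ∀ (b₀ h : ℝ) (a d : Matrix (Fin 1) (Fin 1) ℂ), aᴴ * d = 1 →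
      ‖∫ β : ℝ, archScalarSection 1 s (Matrix.J (Fin 1) ℂ * fromBlocks 1 ((β : ℂ) • (1 : Matrix (Fin 1) (Fin 1) ℂ)) 0 1 *
            (fromBlocks 1 ((b₀ : ℂ) • (1 : Matrix (Fin 1) (Fin 1) ℂ)) 0 1 * fromBlocks a 0 0 d)) * Complex.exp (-(2 * Real.pi * I * h * β))‖ ≤
        C * ‖a 0 0‖ ^ (1 - 2 * s.re) * (1 + ‖a 0 0‖ ^ 2 * |h|) * Real.exp (-(Real.pi * (‖a 0 0‖ ^ 2 * |h|))) := by
  obtain ⟨C, r, hC, hr, hb⟩ := exists_forall_norm_archLineWhittaker_le hz₀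
  refine ⟨C, r, hC, hr, fun s hs b₀ h a d had => ?_⟩
  obtain ⟨ha, -⟩ := norm_det_levi had
  rw [Matrix.det_fin_one] at ha
  have hρ : 0 < ‖a 0 0‖ := norm_pos_iff.2 ha
  have hd : d 0 0 ≠ 0 := by
    intro h0
    have h1 := congrArg (fun M : Matrix (Fin 1) (Fin 1) ℂ => M 0 0) had
    simp only [Matrix.mul_apply, Fin.sum_univ_one, h0, mul_zero, Matrix.one_apply_eq] at h1
    exact zero_ne_one h1
  rw [lineWhittaker_iwasawa (isArchSiegelSection_archScalarSection 1 s) had, norm_mul, norm_mul, norm_mul, norm_exp_phase, one_mul,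
    norm_chiK_eq_one 1 hd, one_mul, Complex.norm_cpow_eq_rpow_re_of_pos hρ,
    show (1 - 2 * s : ℂ).re = 1 - 2 * s.re by simp]
  have h1 := hb s hs (‖a 0 0‖ ^ 2 * h)
  rw [abs_mul, abs_of_nonneg (sq_nonneg _)] at h1
  calc ‖a 0 0‖ ^ (1 - 2 * s.re) * ‖∫ β : ℝ, archScalarSection 1 s (Matrix.J (Fin 1) ℂ * fromBlocks 1 ((β : ℂ) • (1 : Matrix (Fin 1) (Fin 1) ℂ)) 0 1) *
          Complex.exp (-(2 * Real.pi * I * ((‖a 0 0‖ ^ 2 * h : ℝ) : ℂ) * β))‖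
      ≤ ‖a 0 0‖ ^ (1 - 2 * s.re) * (C * (1 + ‖a 0 0‖ ^ 2 * |h|) * Real.exp (-(Real.pi * (‖a 0 0‖ ^ 2 * |h|)))) :=
        mul_le_mul_of_nonneg_left h1 (Real.rpow_nonneg hρ.le _)
    _ = C * ‖a 0 0‖ ^ (1 - 2 * s.re) * (1 + ‖a 0 0‖ ^ 2 * |h|) * Real.exp (-(Real.pi * (‖a 0 0‖ ^ 2 * |h|))) := by ring

/-- **THE IWASAWA-POINT LETTER, MIRROR TYPE `k = −1`** (same shape; ★ `exists_forall_norm_archLineWhittaker_neg_le`). [cite: Bump1997, §1.6, §3.7] -/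
theorem norm_lineWhittaker_iwasawa_neg_le {z₀ : ℂ} (hz₀ : 1 / 2 < z₀.re) :
    ∃ C r : ℝ, 0 ≤ C ∧ 0 < r ∧ ∀ s : ℂ, dist s z₀ < r → ∀ (b₀ h : ℝ) (a d : Matrix (Fin 1) (Fin 1) ℂ), aᴴ * d = 1 →
      ‖∫ β : ℝ, archScalarSection (-1) s (Matrix.J (Fin 1) ℂ * fromBlocks 1 ((β : ℂ) • (1 : Matrix (Fin 1) (Fin 1) ℂ)) 0 1 *
            (fromBlocks 1 ((b₀ : ℂ) • (1 : Matrix (Fin 1) (Fin 1) ℂ)) 0 1 * fromBlocks a 0 0 d)) * Complex.exp (-(2 * Real.pi * I * h * β))‖ ≤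
        C * ‖a 0 0‖ ^ (1 - 2 * s.re) * (1 + ‖a 0 0‖ ^ 2 * |h|) * Real.exp (-(Real.pi * (‖a 0 0‖ ^ 2 * |h|))) := by
  obtain ⟨C, r, hC, hr, hb⟩ := exists_forall_norm_archLineWhittaker_neg_le hz₀
  refine ⟨C, r, hC, hr, fun s hs b₀ h a d had => ?_⟩
  obtain ⟨ha, -⟩ := norm_det_levi had
  rw [Matrix.det_fin_one] at ha
  have hρ : 0 < ‖a 0 0‖ := norm_pos_iff.2 ha
  have hd : d 0 0 ≠ 0 := by
    intro h0
    have h1 := congrArg (fun M : Matrix (Fin 1) (Fin 1) ℂ => M 0 0) had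
    simp only [Matrix.mul_apply, Fin.sum_univ_one, h0, mul_zero, Matrix.one_apply_eq] at h1
    exact zero_ne_one h1
  rw [lineWhittaker_iwasawa (isArchSiegelSection_archScalarSection (-1) s) had, norm_mul, norm_mul, norm_mul, norm_exp_phase, one_mul,
    norm_chiK_eq_one (-1) hd, one_mul, Complex.norm_cpow_eq_rpow_re_of_pos hρ,
    show (1 - 2 * s : ℂ).re = 1 - 2 * s.re by simp]
  have h1 := hb s hs (‖a 0 0‖ ^ 2 * h)
  rw [abs_mul, abs_of_nonneg (sq_nonneg _)] at h1
  calc ‖a 0 0‖ ^ (1 - 2 * s.re) * ‖∫ β : ℝ, archScalarSection (-1) s (Matrix.J (Fin 1) ℂ * fromBlocks 1 ((β : ℂ) • (1 : Matrix (Fin 1) (Fin 1) ℂ)) 0 1) *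
          Complex.exp (-(2 * Real.pi * I * ((‖a 0 0‖ ^ 2 * h : ℝ) : ℂ) * β))‖
      ≤ ‖a 0 0‖ ^ (1 - 2 * s.re) * (C * (1 + ‖a 0 0‖ ^ 2 * |h|) * Real.exp (-(Real.pi * (‖a 0 0‖ ^ 2 * |h|)))) :=
        mul_le_mul_of_nonneg_left h1 (Real.rpow_nonneg hρ.le _)
    _ = C * ‖a 0 0‖ ^ (1 - 2 * s.re) * (1 + ‖a 0 0‖ ^ 2 * |h|) * Real.exp (-(Real.pi * (‖a 0 0‖ ^ 2 * |h|))) := by ring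

end Summit.HodgeConjecture.HodgeConjecture.Cruxes.HLiu418.K2LiuKindOneLineWhittakerIwasawa

end
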